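import Summits.HodgeConjecture.CorCM.GaloisThirtyTwoDividesSmallPrimeHodge
import Summits.HodgeConjecture.CorCM.GaloisQuaternionTimesCyclicDegenerate
import Mathlib.GroupTheory.SpecificGroups.Quaternion
import HarnessLib

/-!
# Shapes Q×/QK, the structure theorem, the Hodge payload and the model family `Gal ≅ Q_{2^{t+2}k} × C_p` FROM A BOTTOM CERTIFICATE
# `Q_{2^{t+2}} × C_p ↪ Gal(K/ℚ) ⟹ BAD` — the `p`-column made parametric

COR-CM (cell `pub-hodgecm2`), binder seat b04 (gen 40), count-neutral own lane «Galois-CM-type classification».  KERNEL ONLY: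
theorems; no definition, no named fact, no `sorry`.  `HC_CM` is neither used nor claimed.

Gen 39 wrote the `p`-column (shapes Q× and QK BAD ⟹ GOOD fields of degree `2ⁿ·p` have shape C(r) or Dic ⟹ the Hodge conjecture for
all powers of all their CM abelian varieties; the Hodge dichotomy; `Gal ≅ Q_{8k} × C_p` BAD) once per prime, always from the bottom
member `Q₈ × C_p` (or `Q₁₆ × C₇`).  For the primes reached by the TWO-SHEET NORM FORMAT of gen 40 the bottom member is `Q₃₂ × C₂₃`,
`Q₆₄ × C₃₁`, `Q₆₄ × C₄₇`, … (`CorCM/GaloisQuaternionCyclicLiftList`, `CorCM/GaloisQuaternionSixtyFourCyclic*Lift`); this file states the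
column ONCE, parametrically in the bottom `Q_{2^{t+2}} × C_p` (`t = 1, 2, 3, 4` for `Q₈, Q₁₆, Q₃₂, Q₆₄`), the bottom certificate entering
as the hypothesis

  `hcert : ∀ A X v, ord A = 2^{t+1} → X² = A^{2^t} → XAX⁻¹ = A⁻¹ → A^{2^t} = c → ord v = p → [A,v] = [X,v] = 1 → ⟨v⟩ ◁ Gal → BAD(K)`

(exactly the shape of the `exists_simple_degenerate_of_quaternion*_cyclic*_subgroup` theorems).

* §1 `exists_simple_degenerate_of_shape_quaternion_of_bottom` — shape Q× of order `2ⁿ·p` for `n ≥ t + 2`, shape QK for `n ≥ t + 3`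
  (`A = a^{2^{n−2−t}}`, an even power of `a` in the QK case, `X = x`).
* §2 `structure_of_forall_isNondegenerate_of_thirtytwo_dvd_of_bottom` — GOOD of degree `2ⁿ·p`, `n ≥ max(5, t+3)` ⟹ shape C(r) or Dic
  (gen 39's five-shape structure theorem `structure_of_forall_isNondegenerate_of_thirtytwo_dvd` minus Q×, QK).
* §3 `hodgeConjectureFor_pow_of_forall_isNondegenerate_of_bottom` — with the residue data `¬ 2^{j+1} ∣ p − 1`, `¬ 2^{n−j} ∣ p + 1`,
  `2j ≤ n` of gen 38's `hodgeConjectureFor_pow_of_shape_C`: GOOD ⟹ the Hodge conjecture for ALL POWERS of EVERY abelian variety with CM by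
  `K`; `hodge_dichotomy_of_bottom`.
* §4 `exists_simple_degenerate_of_mulEquiv_quaternion_prod_cyclic_of_bottom` — `Gal(K/ℚ) ≅ Q_{2^{t+2}k} × C_p` is BAD for every `k ≥ 1`.

## References

* [Shimura1998] G. Shimura, *Abelian Varieties with Complex Multiplication and Modular Functions*, §6.2 Thm. 3, §8.2 Prop. 26, §32.10.
* [Gordon1999HodgeAVSurvey] B. B. Gordon, *A survey of the Hodge conjecture for abelian varieties*, Thm. 6.4, §9.3.
* [Pohlmann1968] H. Pohlmann, *Algebraic cycles on abelian varieties of complex multiplication type*, Ann. of Math. 88 (1968), Thm. 1.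
* [Dodson1984] B. Dodson, *The structure of Galois groups of CM-fields*, Trans. AMS 283 (1984), §3.1.1, §4.1, §5.
-/

noncomputable section

open CategoryTheory CategoryTheory.Limits NumberField
open scoped BigOperators

namespace Summit.HodgeConjecture.CorCM.GaloisModels

open Literature.NumberTheory.ComplexMultiplication Literature.AlgebraicGeometry.HodgeTheory
open Literature.AlgebraicGeometry.Motives (AbelianVariety CMType)
open Literature.AlgebraicGeometry.ComplexMultiplication (IsCMTypeRealisation)
open Literature.AlgebraicGeometry.Pohlmann1968 Summit.HodgeConjecture.CorCM.GaloisRank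
open Literature.Barriers.HodgeConjecture (divisorClassesSpan)
open QuaternionGroup

variable {K : Type} [Field K] [NumberField K] [IsCMField K]

/-! ## §1 Shapes Q× and QK from a bottom certificate -/

/-- **SHAPES Q× (`n ≥ t+2`) AND QK (`n ≥ t+3`) OF ORDER `2ⁿ·p` ARE BAD as soon as `Q_{2^{t+2}} × C_p ↪ Gal` through `c` with `C_p`
normal is** (`hcert`).  `u, a, x ∈ Gal(K/ℚ)`: `ord u = p`, `⟨u⟩ ◁ Gal`, `ord a = 2ⁿ⁻¹`, `x a = a⁻¹ x`, `x² = a^{2ⁿ⁻²} = c`, `x u x⁻¹ = u`,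
`a u a⁻¹ = u` (Q×) or `a u a⁻¹ = u⁻¹` with `n ≥ t + 3` (QK); the subgroup `⟨a^{2^{n−2−t}}, x⟩ × ⟨u⟩ ≅ Q_{2^{t+2}} × C_p` contains `c`.
[cite: Shimura1998, §6.2 Thm. 3 and §8.2 Prop. 26] [cite: Gordon1999HodgeAVSurvey, Thm. 6.4 and §9.3] -/
theorem exists_simple_degenerate_of_shape_quaternion_of_bottom [IsGalois ℚ K] {p n t : ℕ}
    (hcert : ∀ A X v : K ≃ₐ[ℚ] K, orderOf A = 2 ^ (t + 1) → X * X = A ^ 2 ^ t → X * A * X⁻¹ = A⁻¹ →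
      A ^ 2 ^ t = (IsCMField.complexConj K).restrictScalars ℚ → orderOf v = p → A * v = v * A → X * v = v * X →
      (Subgroup.zpowers v).Normal →
      ∃ (Φ : CMType K) (φ₀ : K →+* ℂ) (A : AbelianVariety ℂ) (ι : 𝓞 K →+* End A)
        (θ : K →+* Module.End ℂ (complexBetti A.X 1)),
        IsPrimitive (ℂ ≃+* ℂ) Φ.1 φ₀ ∧ ¬ IsNondegenerate Φ ∧ IsCMTypeRealisation Φ A ι θ ∧ A.IsSimple ∧
        A.dim = Module.finrank ℚ K / 2 ∧
        ∃ n p : ℕ, ∃ x : complexBetti (⨁ fun _ : Fin n => A).X (2 * p), IsRationalClass x ∧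
          IsOfHodgeType (⨁ fun _ : Fin n => A).dim (⨁ fun _ : Fin n => A).X (2 * p) p p x ∧
          x ∉ divisorClassesSpan (⨁ fun _ : Fin n => A).X (⨁ fun _ : Fin n => A).dim p)
    (hn : t + 2 ≤ n) {u a x : K ≃ₐ[ℚ] K} (hu : orderOf u = p) (hnorm : (Subgroup.zpowers u).Normal)
    (ha : orderOf a = 2 ^ (n - 1)) (hxa : x * a = a⁻¹ * x) (hxx : x * x = a ^ 2 ^ (n - 2))
    (hc : a ^ 2 ^ (n - 2) = (IsCMField.complexConj K).restrictScalars ℚ) (hxu : x * u * x⁻¹ = u)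
    (hau : a * u * a⁻¹ = u ∨ (a * u * a⁻¹ = u⁻¹ ∧ t + 3 ≤ n)) :
    ∃ (Φ : CMType K) (φ₀ : K →+* ℂ) (A : AbelianVariety ℂ) (ι : 𝓞 K →+* End A)
      (θ : K →+* Module.End ℂ (complexBetti A.X 1)),
      IsPrimitive (ℂ ≃+* ℂ) Φ.1 φ₀ ∧ ¬ IsNondegenerate Φ ∧ IsCMTypeRealisation Φ A ι θ ∧ A.IsSimple ∧
      A.dim = Module.finrank ℚ K / 2 ∧
      ∃ n p : ℕ, ∃ x : complexBetti (⨁ fun _ : Fin n => A).X (2 * p), IsRationalClass x ∧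
        IsOfHodgeType (⨁ fun _ : Fin n => A).dim (⨁ fun _ : Fin n => A).X (2 * p) p p x ∧
        x ∉ divisorClassesSpan (⨁ fun _ : Fin n => A).X (⨁ fun _ : Fin n => A).dim p := by
  have het : 2 ^ (n - 2 - t) * 2 ^ t = 2 ^ (n - 2) := by rw [← pow_add]; congr 1; omega
  have hA : orderOf (a ^ 2 ^ (n - 2 - t)) = 2 ^ (t + 1) := by
    rw [orderOf_pow_of_dvd (pow_ne_zero _ two_ne_zero) (by rw [ha]; exact pow_dvd_pow 2 (by omega)), ha,
      Nat.pow_div (by omega) two_pos]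
    congr 1
    omega
  have hX : x * x = (a ^ 2 ^ (n - 2 - t)) ^ 2 ^ t := by rw [hxx, ← pow_mul, het]
  have hXA : x * a ^ 2 ^ (n - 2 - t) * x⁻¹ = (a ^ 2 ^ (n - 2 - t))⁻¹ := conj_pow_eq_inv_of_mul_eq hxa _
  have hc' : (a ^ 2 ^ (n - 2 - t)) ^ 2 ^ t = (IsCMField.complexConj K).restrictScalars ℚ := by rw [← pow_mul, het, hc]
  have hAu : a ^ 2 ^ (n - 2 - t) * u = u * a ^ 2 ^ (n - 2 - t) := by
    rcases hau with hau | ⟨hau, hn3⟩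
    · exact ((show Commute a u from mul_comm_of_conj_eq hau).pow_left _).eq
    · have h2e : 2 ^ (n - 2 - t) = 2 * 2 ^ (n - 3 - t) := by rw [← pow_succ']; congr 1; omega
      rw [h2e]
      exact pow_two_mul_comm_of_conj_eq_inv hau _
  have hXu : x * u = u * x := mul_comm_of_conj_eq hxu
  exact hcert _ _ _ hA hX hXA hc' hu hAu hXu hnorm

/-! ## §2 The structure theorem from a bottom certificate -/

/-- **GOOD Galois CM fields of degree `2ⁿ·p` (`p` an odd prime), `n ≥ 5`, `n ≥ t + 3`, with a bottom certificate on `Q_{2^{t+2}} × C_p`: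
shape C(r) or Dic.**  If every primitive CM type of `K` is nondegenerate then complex conjugation is the unique involution of
`Gal(K/ℚ)` and for every Sylow `2`-subgroup `S` (of order `2ⁿ`): EITHER `S = ⟨x⟩` is cyclic, `Gal = ⟨u⟩⟨x⟩` with `ord u = p`, `⟨u⟩ ◁ Gal`,
`x u x⁻¹ = uʳ` (shape C(r)), OR `S = ⟨a, x⟩` is generalised quaternion with `a u a⁻¹ = u`, `x u x⁻¹ = u⁻¹` (shape Dic).
[cite: Shimura1998, §8.2 Prop. 26 and §32.10] [cite: Dodson1984, §3.1.1, §4.1 and §5] -/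
theorem structure_of_forall_isNondegenerate_of_thirtytwo_dvd_of_bottom [IsGalois ℚ K] {n p t : ℕ} (hp : p.Prime) (hp2 : p ≠ 2)
    (hdeg : Module.finrank ℚ K = 2 ^ n * p) (hn : 5 ≤ n) (hnt : t + 3 ≤ n)
    (hcert : ∀ A X v : K ≃ₐ[ℚ] K, orderOf A = 2 ^ (t + 1) → X * X = A ^ 2 ^ t → X * A * X⁻¹ = A⁻¹ →
      A ^ 2 ^ t = (IsCMField.complexConj K).restrictScalars ℚ → orderOf v = p → A * v = v * A → X * v = v * X →
      (Subgroup.zpowers v).Normal →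
      ∃ (Φ : CMType K) (φ₀ : K →+* ℂ) (A : AbelianVariety ℂ) (ι : 𝓞 K →+* End A)
        (θ : K →+* Module.End ℂ (complexBetti A.X 1)),
        IsPrimitive (ℂ ≃+* ℂ) Φ.1 φ₀ ∧ ¬ IsNondegenerate Φ ∧ IsCMTypeRealisation Φ A ι θ ∧ A.IsSimple ∧
        A.dim = Module.finrank ℚ K / 2 ∧
        ∃ n p : ℕ, ∃ x : complexBetti (⨁ fun _ : Fin n => A).X (2 * p), IsRationalClass x ∧
          IsOfHodgeType (⨁ fun _ : Fin n => A).dim (⨁ fun _ : Fin n => A).X (2 * p) p p x ∧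
          x ∉ divisorClassesSpan (⨁ fun _ : Fin n => A).X (⨁ fun _ : Fin n => A).dim p)
    (hgood : ∀ (Φ : CMType K) (φ : K →+* ℂ), IsPrimitive (ℂ ≃+* ℂ) Φ.1 φ → IsNondegenerate Φ) [Fact (Nat.Prime 2)] :
    (∀ σ : K ≃ₐ[ℚ] K, σ * σ = 1 → σ ≠ 1 → σ = (IsCMField.complexConj K).restrictScalars ℚ) ∧
      ∀ S : Sylow 2 (K ≃ₐ[ℚ] K), Nat.card (S : Subgroup (K ≃ₐ[ℚ] K)) = 2 ^ n ∧
        ((∃ u x : K ≃ₐ[ℚ] K, orderOf u = p ∧ (Subgroup.zpowers u).Normal ∧ orderOf x = 2 ^ n ∧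
            Subgroup.zpowers x = (S : Subgroup (K ≃ₐ[ℚ] K)) ∧ (∀ g : K ≃ₐ[ℚ] K, ∃ j i : ℕ, g = u ^ j * x ^ i) ∧
            ∃ r : ℕ, x * u * x⁻¹ = u ^ r) ∨
         (∃ u a x : K ≃ₐ[ℚ] K, orderOf u = p ∧ (Subgroup.zpowers u).Normal ∧ orderOf a = 2 ^ (n - 1) ∧
            a ∈ (S : Subgroup (K ≃ₐ[ℚ] K)) ∧ x ∈ (S : Subgroup (K ≃ₐ[ℚ] K)) ∧ x ∉ Subgroup.zpowers a ∧ x * a = a⁻¹ * x ∧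
            x * x = a ^ 2 ^ (n - 2) ∧ (∀ g : K ≃ₐ[ℚ] K, ∃ j i : ℕ, g = u ^ j * a ^ i ∨ g = u ^ j * (x * a ^ i)) ∧
            a * u * a⁻¹ = u ∧ x * u * x⁻¹ = u⁻¹)) := by
  rcases structure_of_forall_isNondegenerate_of_thirtytwo_dvd hdeg (hp.odd_of_ne_two hp2) hn hgood with
    ⟨hM1, -⟩ | ⟨-, hinv, hS⟩
  · exact absurd hM1 hp.one_lt.ne'
  refine ⟨hinv, fun S => ?_⟩
  obtain ⟨hcardS, hshape⟩ := hS S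
  refine ⟨hcardS, ?_⟩
  rcases hshape with hcyc | ⟨u, a, x, hu, hnorm, ha, haS, hxS, hxa', hxa, hxx, hgen, hshapes⟩
  · exact Or.inl hcyc
  right
  have hc : a ^ 2 ^ (n - 2) = (IsCMField.complexConj K).restrictScalars ℚ := by
    refine hinv _ ?_ ?_
    · rw [← pow_add, ← two_mul, ← pow_succ', show n - 2 + 1 = n - 1 by omega, ← ha, pow_orderOf_eq_one]
    · exact pow_ne_one_of_lt_orderOf (pow_ne_zero _ two_ne_zero)
        (by rw [ha]; exact Nat.pow_lt_pow_right (by norm_num) (by omega))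
  have hbad : (a * u * a⁻¹ = u ∨ (a * u * a⁻¹ = u⁻¹ ∧ t + 3 ≤ n)) → x * u * x⁻¹ = u → False := fun hau hxu => by
    obtain ⟨Φ, φ₀, -, -, -, hprim, hdeg', -⟩ :=
      exists_simple_degenerate_of_shape_quaternion_of_bottom hcert (by omega) hu hnorm ha hxa hxx hc hxu hau
    exact hdeg' (hgood Φ φ₀ hprim)
  rcases hshapes with ⟨hau, hxu⟩ | hdic | ⟨hau, hxu⟩
  · exact (hbad (Or.inl hau) hxu).elim
  · exact ⟨u, a, x, hu, hnorm, ha, haS, hxS, hxa', hxa, hxx, hgen, hdic⟩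
  · exact (hbad (Or.inr ⟨hau, hnt⟩) hxu).elim

/-! ## §3 The Hodge payload and the dichotomy -/

variable {Φ : CMType K} {A : AbelianVariety ℂ} {ι : 𝓞 K →+* End A} {θ : K →+* Module.End ℂ (complexBetti A.X 1)}

/-- **A GOOD Galois CM field of degree `2ⁿ·p` with a bottom certificate on `Q_{2^{t+2}} × C_p` (`n ≥ 5`, `n ≥ t + 3`) and residue data
`¬ 2^{j+1} ∣ p − 1`, `¬ 2^{n−j} ∣ p + 1`, `1 ≤ j`, `2j ≤ n` satisfies the Hodge conjecture for ALL POWERS of EVERY abelian variety with CM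
by `K`** (shape C(r): `ord_p r ∣ 2^j` and gen 38's `hodgeConjectureFor_pow_of_shape_C`; shape Dic: `hodgeConjectureFor_pow_of_shape_dic`).
[cite: Pohlmann1968, Thm. 1] [cite: Shimura1998, §8.2 Prop. 26 and §32.10] [cite: Gordon1999HodgeAVSurvey, Thm. 6.4 and §9.3] -/
theorem hodgeConjectureFor_pow_of_forall_isNondegenerate_of_bottom [IsGalois ℚ K] {n p t j : ℕ} (hp : p.Prime) (hp2 : p ≠ 2)
    (hdeg : Module.finrank ℚ K = 2 ^ n * p) (hn : 5 ≤ n) (hnt : t + 3 ≤ n)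
    (hcert : ∀ A X v : K ≃ₐ[ℚ] K, orderOf A = 2 ^ (t + 1) → X * X = A ^ 2 ^ t → X * A * X⁻¹ = A⁻¹ →
      A ^ 2 ^ t = (IsCMField.complexConj K).restrictScalars ℚ → orderOf v = p → A * v = v * A → X * v = v * X →
      (Subgroup.zpowers v).Normal →
      ∃ (Φ : CMType K) (φ₀ : K →+* ℂ) (A : AbelianVariety ℂ) (ι : 𝓞 K →+* End A)
        (θ : K →+* Module.End ℂ (complexBetti A.X 1)),
        IsPrimitive (ℂ ≃+* ℂ) Φ.1 φ₀ ∧ ¬ IsNondegenerate Φ ∧ IsCMTypeRealisation Φ A ι θ ∧ A.IsSimple ∧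
        A.dim = Module.finrank ℚ K / 2 ∧
        ∃ n p : ℕ, ∃ x : complexBetti (⨁ fun _ : Fin n => A).X (2 * p), IsRationalClass x ∧
          IsOfHodgeType (⨁ fun _ : Fin n => A).dim (⨁ fun _ : Fin n => A).X (2 * p) p p x ∧
          x ∉ divisorClassesSpan (⨁ fun _ : Fin n => A).X (⨁ fun _ : Fin n => A).dim p)
    (hj1 : 1 ≤ j) (hjn : 2 * j ≤ n) (hj : ¬ 2 ^ (j + 1) ∣ p - 1) (h2 : ¬ 2 ^ (n - j) ∣ p + 1)
    (hgood : ∀ (Ψ : CMType K) (φ : K →+* ℂ), IsPrimitive (ℂ ≃+* ℂ) Ψ.1 φ → IsNondegenerate Ψ)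
    (hA : IsCMTypeRealisation Φ A ι θ) (N : ℕ) :
    HodgeConjectureFor (⨁ fun _ : Fin N => A).dim (⨁ fun _ : Fin N => A).X := by
  haveI : Fact (Nat.Prime 2) := ⟨Nat.prime_two⟩
  haveI : Fact p.Prime := ⟨hp⟩
  obtain ⟨S⟩ : Nonempty (Sylow 2 (K ≃ₐ[ℚ] K)) := inferInstance
  obtain ⟨-, hS⟩ := structure_of_forall_isNondegenerate_of_thirtytwo_dvd_of_bottom hp hp2 hdeg hn hnt hcert hgood
  obtain ⟨-, hcyc | hdic⟩ := hS S
  · obtain ⟨u, x, hu, hnorm, hx, -, -, r, hxu⟩ := hcyc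
    haveI := hnorm
    have hx1 : x ^ 2 ^ n = 1 := by rw [← hx, pow_orderOf_eq_one]
    obtain ⟨a, rfl⟩ : ∃ a, n = a + j + 1 := ⟨n - j - 1, by omega⟩
    rw [show a + j + 1 - j = a + 1 by omega] at h2
    exact hodgeConjectureFor_pow_of_shape_C (p := p) hp2 hj1 (by omega) hdeg hu hx hxu
      (pow_two_pow_mod_eq_one_of_conj hu hx1 hxu hj) (not_two_pow_dvd_of_le (e := j + 1) (by omega) hj) h2 hA N
  · obtain ⟨u, a, x, hu, -, ha, -, -, -, hxa, hxx, -, hau, hxu⟩ := hdic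
    obtain ⟨k, rfl⟩ : ∃ k, n = k + 2 := ⟨n - 2, by omega⟩
    exact hodgeConjectureFor_pow_of_shape_dic hdeg hp hp2 hu (by rw [ha, show k + 2 - 1 = k + 1 by omega])
      hau hxu hxa (by rw [hxx, Nat.add_sub_cancel]) hA N

/-- **The Hodge dichotomy for Galois CM fields of degree `2ⁿ·p` with a bottom certificate** (hypotheses of
`hodgeConjectureFor_pow_of_forall_isNondegenerate_of_bottom`): either every abelian variety with CM by `K` satisfies the Hodge
conjecture with all its powers, or `K` carries a SIMPLE DEGENERATE CM abelian variety of dimension `[K:ℚ]/2` with an exceptional Hodge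
class. [cite: Pohlmann1968, Thm. 1] [cite: Shimura1998, §6.2 Thm. 3, §8.2 Prop. 26 and §32.10] [cite: Gordon1999HodgeAVSurvey, Thm. 6.4 and §9.3] -/
theorem hodge_dichotomy_of_bottom [IsGalois ℚ K] {n p t j : ℕ} (hp : p.Prime) (hp2 : p ≠ 2)
    (hdeg : Module.finrank ℚ K = 2 ^ n * p) (hn : 5 ≤ n) (hnt : t + 3 ≤ n)
    (hcert : ∀ A X v : K ≃ₐ[ℚ] K, orderOf A = 2 ^ (t + 1) → X * X = A ^ 2 ^ t → X * A * X⁻¹ = A⁻¹ →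
      A ^ 2 ^ t = (IsCMField.complexConj K).restrictScalars ℚ → orderOf v = p → A * v = v * A → X * v = v * X →
      (Subgroup.zpowers v).Normal →
      ∃ (Φ : CMType K) (φ₀ : K →+* ℂ) (A : AbelianVariety ℂ) (ι : 𝓞 K →+* End A)
        (θ : K →+* Module.End ℂ (complexBetti A.X 1)),
        IsPrimitive (ℂ ≃+* ℂ) Φ.1 φ₀ ∧ ¬ IsNondegenerate Φ ∧ IsCMTypeRealisation Φ A ι θ ∧ A.IsSimple ∧
        A.dim = Module.finrank ℚ K / 2 ∧
        ∃ n p : ℕ, ∃ x : complexBetti (⨁ fun _ : Fin n => A).X (2 * p), IsRationalClass x ∧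
          IsOfHodgeType (⨁ fun _ : Fin n => A).dim (⨁ fun _ : Fin n => A).X (2 * p) p p x ∧
          x ∉ divisorClassesSpan (⨁ fun _ : Fin n => A).X (⨁ fun _ : Fin n => A).dim p)
    (hj1 : 1 ≤ j) (hjn : 2 * j ≤ n) (hj : ¬ 2 ^ (j + 1) ∣ p - 1) (h2 : ¬ 2 ^ (n - j) ∣ p + 1) :
    (∀ (Φ : CMType K) (A : AbelianVariety ℂ) (ι : 𝓞 K →+* End A) (θ : K →+* Module.End ℂ (complexBetti A.X 1)),
        IsCMTypeRealisation Φ A ι θ → ∀ N : ℕ, HodgeConjectureFor (⨁ fun _ : Fin N => A).dim (⨁ fun _ : Fin N => A).X) ∨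
      ∃ (Φ : CMType K) (φ : K →+* ℂ) (X : AbelianVariety ℂ) (ι : 𝓞 K →+* End X)
        (ϑ : K →+* Module.End ℂ (complexBetti X.X 1)),
        IsPrimitive (ℂ ≃+* ℂ) Φ.1 φ ∧ ¬ IsNondegenerate Φ ∧ IsCMTypeRealisation Φ X ι ϑ ∧ X.IsSimple ∧
        X.dim = Module.finrank ℚ K / 2 ∧
        ∃ n p : ℕ, ∃ x : complexBetti (⨁ fun _ : Fin n => X).X (2 * p), IsRationalClass x ∧
          IsOfHodgeType (⨁ fun _ : Fin n => X).dim (⨁ fun _ : Fin n => X).X (2 * p) p p x ∧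
          x ∉ divisorClassesSpan (⨁ fun _ : Fin n => X).X (⨁ fun _ : Fin n => X).dim p := by
  by_cases hgood : ∀ (Ψ : CMType K) (φ : K →+* ℂ), IsPrimitive (ℂ ≃+* ℂ) Ψ.1 φ → IsNondegenerate Ψ
  · exact Or.inl fun Φ A ι θ hA N =>
      hodgeConjectureFor_pow_of_forall_isNondegenerate_of_bottom hp hp2 hdeg hn hnt hcert hj1 hjn hj h2 hgood hA N
  · exact Or.inr (exists_simple_degenerate_of_not_forall_isNondegenerate hgood)

/-! ## §4 The model family `Gal ≅ Q_{2^{t+2}k} × C_p` -/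

/-- **`Gal(K/ℚ) ≅ Q_{2^{t+2}k} × C_p` IS BAD for every `k ≥ 1`**, given the bottom certificate on `Q_{2^{t+2}} × C_p` (`p` odd): the subgroup
`⟨(aᵏ, 1), (x, 1)⟩ × ⟨(1, g)⟩ ≅ Q_{2^{t+2}} × C_p` through `c = (a^{2^t k}, 1)`. [cite: Shimura1998, §6.2 Thm. 3 and §8.2 Prop. 26]
[cite: Gordon1999HodgeAVSurvey, Thm. 6.4 and §9.3] -/
theorem exists_simple_degenerate_of_mulEquiv_quaternion_prod_cyclic_of_bottom [IsGalois ℚ K] {p t k : ℕ} [NeZero p] [NeZero k]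
    (hp : Odd p)
    (hcert : ∀ A X v : K ≃ₐ[ℚ] K, orderOf A = 2 ^ (t + 1) → X * X = A ^ 2 ^ t → X * A * X⁻¹ = A⁻¹ →
      A ^ 2 ^ t = (IsCMField.complexConj K).restrictScalars ℚ → orderOf v = p → A * v = v * A → X * v = v * X →
      (Subgroup.zpowers v).Normal →
      ∃ (Φ : CMType K) (φ₀ : K →+* ℂ) (A : AbelianVariety ℂ) (ι : 𝓞 K →+* End A)
        (θ : K →+* Module.End ℂ (complexBetti A.X 1)),
        IsPrimitive (ℂ ≃+* ℂ) Φ.1 φ₀ ∧ ¬ IsNondegenerate Φ ∧ IsCMTypeRealisation Φ A ι θ ∧ A.IsSimple ∧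
        A.dim = Module.finrank ℚ K / 2 ∧
        ∃ n p : ℕ, ∃ x : complexBetti (⨁ fun _ : Fin n => A).X (2 * p), IsRationalClass x ∧
          IsOfHodgeType (⨁ fun _ : Fin n => A).dim (⨁ fun _ : Fin n => A).X (2 * p) p p x ∧
          x ∉ divisorClassesSpan (⨁ fun _ : Fin n => A).X (⨁ fun _ : Fin n => A).dim p)
    (e : (K ≃ₐ[ℚ] K) ≃* QuaternionGroup (2 ^ t * k) × Multiplicative (ZMod p)) :
    ∃ (Φ : CMType K) (φ₀ : K →+* ℂ) (A : AbelianVariety ℂ) (ι : 𝓞 K →+* End A)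
      (θ : K →+* Module.End ℂ (complexBetti A.X 1)),
      IsPrimitive (ℂ ≃+* ℂ) Φ.1 φ₀ ∧ ¬ IsNondegenerate Φ ∧ IsCMTypeRealisation Φ A ι θ ∧ A.IsSimple ∧
      A.dim = Module.finrank ℚ K / 2 ∧
      ∃ n p : ℕ, ∃ x : complexBetti (⨁ fun _ : Fin n => A).X (2 * p), IsRationalClass x ∧
        IsOfHodgeType (⨁ fun _ : Fin n => A).dim (⨁ fun _ : Fin n => A).X (2 * p) p p x ∧
        x ∉ divisorClassesSpan (⨁ fun _ : Fin n => A).X (⨁ fun _ : Fin n => A).dim p := by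
  have hk : 0 < k := Nat.pos_of_ne_zero (NeZero.ne k)
  have ht : 0 < 2 ^ t := pow_pos two_pos t
  haveI : NeZero (2 ^ t * k) := ⟨(Nat.mul_pos ht hk).ne'⟩
  set A₀ : QuaternionGroup (2 ^ t * k) × Multiplicative (ZMod p) := (a (k : ZMod (2 * (2 ^ t * k))), 1) with hA₀
  set X₀ : QuaternionGroup (2 ^ t * k) × Multiplicative (ZMod p) := (xa 0, 1) with hX₀
  set u₀ : QuaternionGroup (2 ^ t * k) × Multiplicative (ZMod p) := (1, Multiplicative.ofAdd 1) with hu₀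
  have hkval : ((k : ℕ) : ZMod (2 * (2 ^ t * k))).val = k := by
    rw [ZMod.val_natCast]
    exact Nat.mod_eq_of_lt (by nlinarith)
  have hA₀ord : orderOf A₀ = 2 ^ (t + 1) := by
    rw [hA₀, Prod.orderOf_mk, orderOf_one, Nat.lcm_one_right, orderOf_a, hkval,
      show 2 * (2 ^ t * k) = 2 ^ (t + 1) * k by ring, Nat.gcd_mul_left_left, Nat.mul_div_cancel _ hk]
  have hapow : ∀ N : ℕ, (a (k : ZMod (2 * (2 ^ t * k))) : QuaternionGroup (2 ^ t * k)) ^ N = a ((N * k : ℕ) : ZMod _) := by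
    intro N
    induction N with
    | zero => rw [pow_zero, Nat.zero_mul, Nat.cast_zero, a_zero]
    | succ N ih =>
      rw [pow_succ, ih, a_mul_a]
      congr 1
      push_cast
      ring
  have hA₀pow : A₀ ^ 2 ^ t = (a ((2 ^ t * k : ℕ) : ZMod (2 * (2 ^ t * k))), 1) := by
    rw [hA₀, Prod.pow_mk, one_pow, hapow]
  have hX₀sq : X₀ * X₀ = A₀ ^ 2 ^ t := by
    rw [hA₀pow, hX₀, Prod.mk_mul_mk, xa_mul_xa, mul_one, add_zero, sub_zero]
  have hXA₀ : X₀ * A₀ * X₀⁻¹ = A₀⁻¹ := by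
    have hinv : A₀⁻¹ = (a (-(k : ZMod (2 * (2 ^ t * k)))), 1) := by
      rw [hA₀, Prod.inv_mk, inv_one]
      congr 1
    rw [mul_inv_eq_iff_eq_mul, hinv, hX₀, hA₀, Prod.mk_mul_mk, Prod.mk_mul_mk, xa_mul_a, a_mul_xa, zero_add, zero_sub,
      neg_neg]
  have hcomm : ∀ y : QuaternionGroup (2 ^ t * k) × Multiplicative (ZMod p), y * u₀ = u₀ * y := fun y => by
    rw [hu₀]
    ext
    · simp
    · change y.2 * Multiplicative.ofAdd 1 = Multiplicative.ofAdd 1 * y.2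
      exact mul_comm _ _
  have hu₀ord : orderOf u₀ = p := by
    rw [hu₀, Prod.orderOf_mk, orderOf_one, Nat.lcm_one_left, orderOf_ofAdd_eq_addOrderOf, ZMod.addOrderOf_one]
  -- transport to `Gal(K/ℚ)`
  have hc : e ((IsCMField.complexConj K).restrictScalars ℚ) = A₀ ^ 2 ^ t := by
    rw [hA₀pow]
    exact map_complexConj_eq_of_mulEquiv_quaternion_prod hp e
  have hA : orderOf (e.symm A₀) = 2 ^ (t + 1) := by rw [MulEquiv.orderOf_eq, hA₀ord]
  have hX : e.symm X₀ * e.symm X₀ = e.symm A₀ ^ 2 ^ t := by rw [← map_mul, hX₀sq, map_pow]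
  have hXA : e.symm X₀ * e.symm A₀ * (e.symm X₀)⁻¹ = (e.symm A₀)⁻¹ := by
    rw [← map_mul, ← map_inv, ← map_mul, hXA₀, map_inv]
  have hc' : e.symm A₀ ^ 2 ^ t = (IsCMField.complexConj K).restrictScalars ℚ := by
    rw [← map_pow, ← hc, MulEquiv.symm_apply_apply]
  have hu : orderOf (e.symm u₀) = p := by rw [MulEquiv.orderOf_eq, hu₀ord]
  have hAu : e.symm A₀ * e.symm u₀ = e.symm u₀ * e.symm A₀ := by rw [← map_mul, hcomm, map_mul]
  have hXu : e.symm X₀ * e.symm u₀ = e.symm u₀ * e.symm X₀ := by rw [← map_mul, hcomm, map_mul]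
  have hnorm : (Subgroup.zpowers (e.symm u₀)).Normal := by
    refine ⟨fun n hn g => ?_⟩
    obtain ⟨j, rfl⟩ := Subgroup.mem_zpowers_iff.mp hn
    have hcg : Commute (e.symm u₀) g := by
      have := hcomm (e g)
      apply_fun e.symm at this
      rw [map_mul, map_mul, MulEquiv.symm_apply_apply] at this
      exact this.symm
    rw [← (hcg.zpow_left j).eq, mul_inv_cancel_right]
    exact Subgroup.zpow_mem _ (Subgroup.mem_zpowers _) _
  exact hcert _ _ _ hA hX hXA hc' hu hAu hXu hnorm

end Summit.HodgeConjecture.CorCM.GaloisModels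

end
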